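import Summits.BirchSwinnertonDyer.Rank1Residual.Additive.GordBranchPAdicGrossZagier
import Summits.BirchSwinnertonDyer.Rank1Residual.Additive.GordBranchPAdicGrossZagierOdd
import Summits.BirchSwinnertonDyer.Rank1Residual.AdditivePotMult.PotMultBranchPAdicGrossZagier
import Summits.BirchSwinnertonDyer.Rank1Residual.Additive.CensusX42BSD
import Literature.NumberTheory.EllipticCurves.Disegni2017.TwistedBranchLeadingTerm
import HarnessLib

/-!
# Row B6 (O7-ord), defect 2: the twisted-branch `p`-adic Gross–Zagier clauses
# (`Literature.….Disegni2017.TwistedBranchGrossZagierAt`, cell theorem PROOF-gz Thm. 1) ⟹ the cell's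
# typed O7 inputs `BranchPAdicGrossZagier{,Odd}At`, `BranchPAdicGrossZagierMultAt` (rank-one clause),
# and the valuation bookkeeping of the twisted identity with the one-number certificate
# (cell `bsd-addord`, FULL-BSD rank-≤ 1 programme D-0033 tranche 1a, seat `bsd-addord-gz`, session 3;
# planner rulings R-O7 (2) / R-O7″ (1)(3), `run/shared/lean/pub/bsd-addord/TARGET.md` §8; first of two
# files — the per-pair `BSD(E,p)` pipelines are the sequel `TwistedBranchPAdicGrossZagierBSD.lean`)

HONEST FRAMING. Theorems only: no definition, no named fact minted here, no `sorry`, nothing booked,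
no label of the residual map changed. The ONE non-published input is DISPLAYED as the hypothesis
`(h : TwistedBranchGrossZagierAt W p Dh)` — the bare `Prop` (nothing asserted) of
`Literature/NumberTheory/EllipticCurves/Disegni2017/TwistedBranchLeadingTerm.lean` (gate p402187), whose
rank-one clauses are a CELL THEOREM: PROOF-gz.md Thm. 1 (text of record v1, sha256 63cb6b30a0a95466…,
archived v1.3 = v1 + GZ-H under `run/shared/lean/pub/bsd-addord/frozen/`), proved on paper from
Disegni 2017 Thm. A/B (+ Disegni 2022 Thm. B and its 2025 Correction on (M)), Yuan–Zhang–Zhang,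
Mazur–Tate–Teitelbaum, Perrin-Riou (calibration) and Pal; cross-family referee verdict **REF-gz: PASS
(Theorem 1, Cor. 2, Cor. 3) with condition GZ-H** (`run/shared/lean/pub/bsd-addord/REF-gz.md`,
2026-08-25). It is NOT a theorem in print and NOT asserted in the tree; every consumer below takes it
as a binder (the same file's named fact `delbourgoDatum_rankOne_leadingTerms` packages it with
Delbourgo 2002 Thm. (B) for ONE datum `Dh`; that fact is displayed only in the sequel file).

REFEREE CONDITION GZ-H (binding locator sentence, carried verbatim in substance here and on every
declaration below whose statement covers the locus (M) ∩ {`V` split multiplicative}): the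
identification of Disegni's canonical `p`-adic height with Schneider's norm-adapted height used in
PROOF-gz §3.3 (Lemma H) is the (n-exc)-CONDITIONAL printed sentence Disegni, Compos. Math. 153 (2017)
Rem. 1.3.2 (arXiv v3 p. 9 = TeX p0007 L48) together with Disegni, Invent. Math. 230 (2022) Thm. B
context (TeX p0007 L55–62: under (n-exc) the canonical height coincides with all other `p`-adic height
pairings), with (n-exc) DISCHARGED because `ε_p` is ramified (PROOF-gz 3.1 (iv): `Z_w ≠ 0` also for
split `V`); it is NOT Delbourgo 2002 p. 62's unconditional sentence, and Nekovář 1993 §7.14 (the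
sentence's source) is not held on the hub (acq-10827), so the verification trail is the printed
statements of Disegni 2017/2022.

## What

* §1 `branchPAdicGrossZagierAt_of_twisted`, `branchPAdicGrossZagierOddAt_of_twisted`,
  `branchPAdicGrossZagierMultAt_of_twisted`: for `r_an(E) = 1` (so `rank E(ℚ) = 1` by GZK), the
  twisted-branch clauses for a datum `Dh` give the route's typed analytic inputs
  `BranchPAdicGrossZagierAt W p Dh` (T-O7 step 2, even branch, good ordinary twist),
  `BranchPAdicGrossZagierOddAt W p Dh` (odd branch) and `AdditivePotMult.BranchPAdicGrossZagierMultAt W p Dh`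
  ((M), both parities; `a_p(E♭) = ±1` read off the newform) — the rank-one clause these `@[conjecture]`
  inputs were waiting for (their rank-zero clause is a tree theorem, Birch–Pal–MTT).
* §2 `padicValRat_add_valuation_eq_one_of_twisted_identity`: valuation bookkeeping of the identity
  `ϖ·[T¹]B·log_p γ = u·q·Reg_p(Dh)` with the one-number certificate `‖ϖ·[T¹]B‖_p = 1`:
  `Reg_p(Dh) ≠ 0` (Schneider for `Dh`) and `ord_p q + ord_p Reg_p(Dh) = 1` — the edge to the
  `CensusX42` valuation relation consumed by the sequel's four `BSD(E,p)` pipelines.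

## What is NOT claimed

No booking; no main-conjecture statement; nothing at defect `3,4,6` (that is
`TameBranchGrossZagier.lean`, PROOF-gz2), at a potentially supersingular `p`, at `p = 2`, in rank `≠ 1`;
Schneider class-wide; the sign of `u`.

References: [Disegni2017] Thm. A, B, Rem. 1.3.2; [Delbourgo2002] `⟨,⟩_{p,ℚ}` p. 39, (B) p. 40;
[Delbourgo1998] §2.5; [MazurTateTeitelbaum1986Invent] §I.10, §I.13–I.14; [Pal2012] Thm. 3.2; cell memo
PROOF-gz.md §3, §5, §8.
-/

noncomputable section

open scoped Classical MatrixGroups ModularForm NumberField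

open CongruenceSubgroup WeierstrassCurve NumberField IsDedekindDomain
  Literature.NumberTheory.EllipticCurves Literature.NumberTheory.EllipticCurves.ModularForms
  Literature.NumberTheory.EllipticCurves.Rank1Residual
  Literature.NumberTheory.EllipticCurves.Rank1Residual.Typed
  Literature.NumberTheory.EllipticCurves.Delbourgo2002
  Literature.NumberTheory.EllipticCurves.Disegni2017

namespace Summit.BirchSwinnertonDyer.Rank1Residual.Additive

variable {W : WeierstrassCurve ℚ} [W.IsElliptic] [W.IsGloballyMinimal] {p : ℕ} [hp : Fact p.Prime]
  {Dh : PAdicHeightData W p}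

/-! ### §1 The twisted-branch clauses give the route's typed analytic inputs (rank-one clause) -/

/-- **Twisted-branch clauses ⟹ `BranchPAdicGrossZagierAt W p Dh`** (even branch `p ≡ 1 (mod 4)`, good
ordinary twist `V`, `C • V^{(p)} = W`) for a curve of analytic rank one (`rank E(ℚ) = 1` by GZK,
`hGZK`): the rank-one clause of T-O7's typed input, from PROOF-gz Thm. 1 as typed in
`TwistedBranchGrossZagierAt`. [cite: Disegni2017, Thm. B (§1.3.2) (provenance of the clause; entered as the hypothesis `h`)]
[cite: MazurTateTeitelbaum1986Invent, §I.13–I.14] -/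
theorem branchPAdicGrossZagierAt_of_twisted (hGZK : rank_eq_analyticRank_of_analyticRank_le_one)
    (hr : W.analyticRank = 1) (h : TwistedBranchGrossZagierAt W p Dh) :
    BranchPAdicGrossZagierAt W p Dh := by
  intro V _ _ N _ f hp4 hVW hord hf ϖ hϖ
  have hmw : W.mordellWeilRank = 1 := by rw [(hGZK W (by rw [hr])).1, hr]
  obtain ⟨C, hC⟩ := hVW
  obtain ⟨q, hlead, heven, -⟩ := h hr V f (Or.inl hord.1) hf
  have hordin : IsOrdinaryAt V p := ⟨hord.1, hord.2⟩
  obtain ⟨u, hu⟩ := (heven C ϖ hp4 hC hϖ).1 hordin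
  refine ⟨u, q, hlead, ?_⟩
  rw [hmw, pow_one]
  exact_mod_cast hu

/-- **Twisted-branch clauses ⟹ `BranchPAdicGrossZagierOddAt W p Dh`** (odd branch `p ≡ 3 (mod 4)`, good
ordinary twist `V`, `C • V^{(−p)} = W`), analytic rank one.
[cite: Disegni2017, Thm. B (§1.3.2) (provenance of the clause; entered as the hypothesis `h`)]
[cite: MazurTateTeitelbaum1986Invent, §I.13–I.14] -/
theorem branchPAdicGrossZagierOddAt_of_twisted (hGZK : rank_eq_analyticRank_of_analyticRank_le_one)
    (hr : W.analyticRank = 1) (h : TwistedBranchGrossZagierAt W p Dh) :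
    BranchPAdicGrossZagierOddAt W p Dh := by
  intro V _ _ N _ f hp4 hVW hord hf ϖ hϖ
  have hmw : W.mordellWeilRank = 1 := by rw [(hGZK W (by rw [hr])).1, hr]
  obtain ⟨C, hC⟩ := hVW
  obtain ⟨q, hlead, -, hodd⟩ := h hr V f (Or.inl hord.1) hf
  have hordin : IsOrdinaryAt V p := ⟨hord.1, hord.2⟩
  obtain ⟨u, hu⟩ := (hodd C ϖ hp4 hC hϖ).1 hordin
  refine ⟨u, q, hlead, ?_⟩
  rw [hmw, pow_one]
  exact_mod_cast hu

/-- **Twisted-branch clauses ⟹ `BranchPAdicGrossZagierMultAt W p Dh`** (potentially multiplicative locus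
(M), both parities; `a_p(V) = ±1` read off the newform: `IsNewformOf.cuspCoeff_eq_one_and_sq_of_split`,
`…_eq_neg_one_and_dvd_of_nonsplit`), analytic rank one. GZ-H (REF-gz.md, binding on this (M)
statement, which covers `V` split multiplicative): the height identification behind the clause `h` on
(M) ∩ {`V` split} is the (n-exc)-conditional printed sentence Disegni 2017 Rem. 1.3.2 (TeX p0007 L48) +
Disegni 2022 Thm. B context (TeX p0007 L55–62), (n-exc) discharged by `ε_p` ramified (PROOF-gz 3.1 (iv));
not Delbourgo 2002 p. 62; Nekovář 1993 §7.14 unheld (acq-10827).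
[cite: Disegni2017, Thm. B (§1.3.2) and Rem. 1.3.2 (provenance of the clause; entered as the hypothesis `h`)]
[cite: MazurTateTeitelbaum1986Invent, §I.10, §I.13] -/
theorem branchPAdicGrossZagierMultAt_of_twisted (hGZK : rank_eq_analyticRank_of_analyticRank_le_one)
    (hr : W.analyticRank = 1) (h : TwistedBranchGrossZagierAt W p Dh) :
    BranchPAdicGrossZagierMultAt W p Dh := by
  intro V _ _ N _ f B hp2 hVW hVB hf ϖ hϖ
  have hmw : W.mordellWeilRank = 1 := by rw [(hGZK W (by rw [hr])).1, hr]
  have hodd : p % 4 = 1 ∨ p % 4 = 3 := by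
    obtain ⟨k, hk⟩ := hp.out.odd_of_ne_two hp2
    omega
  obtain ⟨C, hC⟩ := hVW
  have hmult : Mult V p := by
    rcases hVB with ⟨hs, -⟩ | ⟨hm, -, -⟩
    · exact hs.hasMultiplicativeReductionAtPrime
    · exact hm
  obtain ⟨q, hlead, heven, hoddc⟩ := h hr V f (Or.inr hmult) hf
  -- `a = a_p(V) = ±1` and `B` is the one-term branch at `a`
  have hLa : ∃ a : ℤ, V.LFunction p = a ∧
      B = if Even (p / 2) then padicLFunctionPlusBranchMult f ((a : ℤ) : ℚ_[p]) (p / 2)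
        else padicLFunctionMinusBranchMult f ((a : ℤ) : ℚ_[p]) (p / 2) := by
    rcases hVB with ⟨hs, hB⟩ | ⟨hm, hns, hB⟩
    · refine ⟨1, ?_, by rw [hB]; push_cast; rfl⟩
      have h1 := (hf.cuspCoeff_eq_one_and_sq_of_split hs).1
      rw [hf.2 p] at h1
      exact_mod_cast h1
    · refine ⟨-1, ?_, by rw [hB]; push_cast; rfl⟩
      have h1 := (hf.cuspCoeff_eq_neg_one_and_dvd_of_nonsplit hm hns).1
      rw [hf.2 p] at h1
      exact_mod_cast h1
  obtain ⟨a, hLa, hB⟩ := hLa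
  rcases hodd with h1 | h3
  · have hev : Even (p / 2) := ⟨p / 4, by omega⟩
    rw [if_pos hev] at hϖ hB
    have hC' : C • V.quadraticTwist (p : ℚ) = W := by
      rw [pStar_eq_of_mod_four p (Or.inl h1), if_pos h1] at hC
      exact hC
    obtain ⟨u, hu⟩ := (heven C ϖ h1 hC' hϖ).2 hmult
    refine ⟨u, q, hlead, ?_⟩
    rw [hmw, pow_one, hB, ← hLa]
    exact_mod_cast hu
  · have hne : ¬ Even (p / 2) := by
      rw [Nat.not_even_iff_odd]
      exact ⟨p / 4, by omega⟩
    rw [if_neg hne] at hϖ hB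
    have hC' : C • V.quadraticTwist (-(p : ℚ)) = W := by
      rw [pStar_eq_of_mod_four p (Or.inr h3), if_neg (by omega)] at hC
      exact hC
    obtain ⟨u, hu⟩ := (hoddc C ϖ h3 hC' hϖ).2 hmult
    refine ⟨u, q, hlead, ?_⟩
    rw [hmw, pow_one, hB, ← hLa]
    exact_mod_cast hu

/-! ### §2 Valuation bookkeeping of the twisted identity with the one-number certificate -/

/-- Valuation bookkeeping: the twisted Gross–Zagier identity `x·log_p γ = u·q·R` (`x = ϖ·[T¹]B`) with
`‖x‖_p = 1` (the one-number certificate), `u ∈ ℤ_p^×`, `q ∈ ℚ^×`, `p ≠ 2` (`ord_p log_p γ = 1`) gives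
`R ≠ 0` and `ord_p q + ord_p R = 1` (via `CensusX42.padicValRat_add_valuation_eq_one_of_identity` with
`κ = 1`, after inserting `#E(ℚ)_tors², ∏ c_ℓ ≠ 0`). [cite: Delbourgo1998, §2.5 BS-D(p) (ii) (pp. 151–152) (shape of the identity)] -/
theorem padicValRat_add_valuation_eq_one_of_twisted_identity (W : WeierstrassCurve ℚ) [W.IsElliptic]
    (hp2 : p ≠ 2) {x R : ℚ_[p]}
    {u : ℤ_[p]ˣ} {q : ℚ} (hq : q ≠ 0) (hx : ‖x‖ = 1)
    (hid : x * padicLog p (cyclotomicGenerator p) = ((u : ℤ_[p]) : ℚ_[p]) * (q : ℚ_[p]) * R) :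
    R ≠ 0 ∧ padicValRat p q + R.valuation = 1 := by
  obtain ⟨hℓ0, hℓ⟩ := X2.valuation_padicLog_cyclotomicGenerator (p := p) hp2
  have hun : ‖((u : ℤ_[p]) : ℚ_[p])‖ = 1 := by
    rw [← PadicInt.norm_def]; exact PadicInt.isUnit_iff.mp u.isUnit
  obtain ⟨hu0, hu⟩ := CensusX42.valuation_eq_zero_of_norm_eq_one (p := p) hun
  obtain ⟨h10, h1⟩ := CensusX42.valuation_eq_zero_of_norm_eq_one (p := p) (t := (1 : ℚ_[p])) norm_one
  have hTpos : 0 < W.torsionOrder := W.torsionOrder_pos_holds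
  have hPpos : 0 < W.tamagawaProduct := W.tamagawaProduct_pos_holds
  have hT : (W.torsionOrder : ℚ_[p]) ≠ 0 := by exact_mod_cast hTpos.ne'
  have hP : (W.tamagawaProduct : ℚ_[p]) ≠ 0 := by exact_mod_cast hPpos.ne'
  have hPq : (W.tamagawaProduct : ℚ) ≠ 0 := by exact_mod_cast hPpos.ne'
  have hid' : x * padicLog p (cyclotomicGenerator p) * (W.torsionOrder : ℚ_[p]) ^ 2 =
      ((u : ℤ_[p]) : ℚ_[p]) * 1 *
        ((((q * (W.torsionOrder : ℚ) ^ 2 / W.tamagawaProduct : ℚ) : ℚ_[p])) * R *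
          (W.tamagawaProduct : ℚ_[p])) := by
    rw [hid]
    push_cast
    field_simp
  exact CensusX42.padicValRat_add_valuation_eq_one_of_identity (W := W) hq hx hℓ0 hℓ hu0 hu h10 h1 hid'


end Summit.BirchSwinnertonDyer.Rank1Residual.Additive

end
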